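import Mathlib
import Summits.CriticalPhenomena.CardyFormulaZ2.Theorems.CardySelfRefinementDefs
import Summits.CriticalPhenomena.CardyFormulaZ2.Theorems.CardySelfRefinementRussoDriftModel
import Summits.CriticalPhenomena.CardyFormulaZ2.Theorems.CardySelfRefinementTrivialSectorRateStubFourArmAboveOneCircuitBitsPivotal
import Summits.CriticalPhenomena.CardyFormulaZ2.Theorems.CardySelfRefinementTrivialSectorRateStubFourArmAboveOneCircuitBits
import Literature.Probability.Percolation.RevealmentOrthogonality
import Literature.Probability.Percolation.BoundaryExplorerRevealment
import Literature.Probability.Percolation.SelfRefinementMeasure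
import HarnessLib

/-!
# Helper (M4b), part 1, of stub `stub_fourArmAboveOne`, line `far-field-is-a-quarter-turn`
(crux `TrivialSectorRate`, stmt-CriticalPhenomena-10266): the EXPLORER identities of Garban's
scheme for the dependent model `M_k` — (B.7) orthogonality of revealed bits, and
`E[f C ; block pivotal] = E[f C ; block examined]`

The Garban scheme data `hS` of the percolation-free reduction `fourArmAboveOneAlong_of_garbanScheme`
(file `…StubFourArmAboveOneReduction.lean`) asks, for the self-refinement law `M_k(ρ,c₀)`, for
revealment events `V_j` of the blocks `Q_j` with (B.7) vanishing nondiagonal terms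
`∫ (1_{V_i} C_i)(1_{V_j} C_j) dM_k = 0` and the separation input `M_k(four arms) ≲ E[X C_j ; V_j]`.
For `P_p` the tree proves these in the adaptive-probing framework `Explorer`
(`RevealmentOrthogonality.lean`), using the product structure in exactly one way: an event
determined by the edges OFF a block is independent of a bit read off the block.  `M_k` is not a
product measure on bond configurations, but for a block `Q = blockPairs j R` ALIGNED with the
coarse lattice `kℤ²` (`k ∣ j i ± R`) its inside `ω ∩ Q` and its outside `ω ∖ Q` ARE independent
under `M_k` (`M_integral_mul_eq_mul_integral_of_aligned`, file `…CircuitBitsPivotal.lean`: bundles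
never straddle an aligned block).  Hence the SAME edge-level explorers of bond configurations (in
particular the boundary-interface explorer `boundaryExplorer R`) serve the dependent model:

* `integral_revealedBits_mul_eq_zero_of_decoupled` — (B.7) for ANY law `μ` on bond configurations
  under which each of the two disjoint blocks is independent of its outside (port of the tree's
  proof: split along the first time the probes meet both blocks and the history before it; that
  history misses one block, whose mean-zero bit factors out);
* `M_integral_revealedBits_mul_eq_zero` (registered helper) — **(B.7) for `M_k(ρ,c₀)`, any
  explorer, two disjoint aligned blocks and mean-zero bits**: the input `horth` of `hS`;
* `integral_indicator_pivotal_mul_bit_eq_setIntegral_revealed_of_decoupled` — for any such `μ`,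
  `∫ 1_{Q pivotal for f} f C dμ = ∫_{Q examined} f C dμ` when the pivotal event is a.s. examined
  (van den Berg–Nolin's form: the revealment event of `Q` is determined by the edges off `Q`,
  `Explorer.determinedBy_revealed`, and off the pivotal event `f(ω) = f(ω ∖ Q)`);
* `M_integral_indicator_pivotal_mul_bit_eq_setIntegral_revealed` (registered helper) — the same
  for `M_k(ρ,c₀)` and an aligned block.

Part 2 (file `…ExplorerScheme.lean`) assembles `hS` from these, the block estimate, (B.5), and
the deterministic facts "pivotal ⟹ examined ⟹ two arms" of `BoundaryExplorerRevealment.lean`.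

References: O. Schramm, S. Smirnov (app. C. Garban), Ann. Probab. 39 (2011), App. B, proof of
Lemma B.1, (B.5)–(B.8); J. van den Berg, P. Nolin, Progr. Probab. 77 (2020), §5.2.

Target file:
`Summits/CriticalPhenomena/CardyFormulaZ2/Theorems/CardySelfRefinementTrivialSectorRateStubFourArmAboveOneExplorer.lean`.
-/

noncomputable section

namespace Summit.CriticalPhenomena.CardyFormulaZ2.Theorems.CardySelfRefinement.FarField

open scoped Classical
open Set MeasureTheory ProbabilityTheory
open Literature.Probability.LatticeModels Literature.Probability.Percolation
open Literature.Probability.Percolation.ProbeHistory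
open Literature.Probability.Percolation.QuadCrossing
open Summit.CriticalPhenomena.CardyFormulaZ2.Theses.CardySelfRefinement

/-! ### Reading events and bits off one side of a block -/

/-- An event determined by an edge set `S` disjoint from `B` does not see the edges of `B`:
its indicator at `ω` is its indicator at `ω ∖ B`. -/
theorem indicator_one_eq_indicator_sdiff_of_determinedBy {V : Type*} {A : Set (BondConfig V)}
    {S B : Set (Sym2 V)} (hA : DeterminedBy A S) (hSB : Disjoint S B) (ω : BondConfig V) :
    A.indicator (1 : BondConfig V → ℝ) ω = A.indicator 1 (ω \ B) := by
  have key : ω ∈ A ↔ ω \ B ∈ A := by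
    refine (determinedBy_iff _ _).1 hA ω (ω \ B) (Set.ext fun e => ?_)
    simp only [Set.mem_inter_iff, Set.mem_sdiff]
    constructor
    · rintro ⟨he, hs⟩; exact ⟨⟨he, Set.disjoint_left.1 hSB hs⟩, hs⟩
    · rintro ⟨⟨he, -⟩, hs⟩; exact ⟨he, hs⟩
  by_cases h : ω ∈ A
  · rw [Set.indicator_of_mem h, Set.indicator_of_mem (key.1 h), Pi.one_apply, Pi.one_apply]
  · rw [Set.indicator_of_notMem h, Set.indicator_of_notMem (fun h' => h (key.2 h'))]

/-- A bit read off `B₂` does not see the edges of a disjoint block `B₁`. -/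
theorem obs_sdiff_eq_of_disjoint {V : Type*} {B₁ B₂ : Finset (Sym2 V)} (hB : Disjoint B₁ B₂)
    (ω : BondConfig V) : obs (ω \ (↑B₁ : Set (Sym2 V))) B₂ = obs ω B₂ :=
  obs_congr fun e he => by
    simp only [Set.mem_sdiff, Finset.mem_coe]
    exact ⟨fun h => h.1, fun h => ⟨h, fun h1 => Finset.disjoint_left.1 hB h1 he⟩⟩

/-- A bit read off `B` only sees the edges of `B`. -/
theorem obs_inter_eq {V : Type*} (B : Finset (Sym2 V)) (ω : BondConfig V) :
    obs (ω ∩ (↑B : Set (Sym2 V))) B = obs ω B :=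
  obs_congr fun e he => by simp [he]

/-! ### (B.7) Orthogonality of revealed bits, for a measure decoupled across the two blocks -/

/-- **(B.7) for a general law `μ` under which each of the two blocks is independent of its
outside.**  Let `E` be any explorer, `B₁`, `B₂` disjoint finite edge sets such that under `μ` the
restriction `ω ∩ B_l` of the configuration to `B_l` is independent of its restriction `ω ∖ B_l`
off `B_l` (`l = 1, 2`; in product form for bounded measurable test functions), and
`φ₁ (obs ω B₁)`, `φ₂ (obs ω B₂)` bits of `μ`-mean zero.  With `Y_l` the indicator that some probe
made before time `n` meets `B_l`, `∫ (C₁ Y₁)(C₂ Y₂) dμ = 0`.  (Port of the tree's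
`Explorer.integral_revealedBits_mul_eq_zero`, Schramm–Smirnov 2011 App. B after (B.8), with the
product structure of `P_p` replaced by the block decoupling hypothesis: split along the first time
`t` the probes meet both blocks and the history `h` before; `h` misses one block, say `B_l`, and
`1_{hist t = h} · C_{3-l}` is a function of `ω ∖ B_l`, while `C_l` is a function of `ω ∩ B_l`.) -/
theorem integral_revealedBits_mul_eq_zero_of_decoupled {V : Type*} [Countable V]
    (μ : Measure (BondConfig V)) [IsFiniteMeasure μ] (E : Explorer V) (n : ℕ)
    {B₁ B₂ : Finset (Sym2 V)} (hB : Disjoint B₁ B₂)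
    (hind₁ : ∀ (F G : BondConfig V → ℝ), Measurable F → Measurable G → (∃ C, ∀ ω, |F ω| ≤ C) →
      (∃ C, ∀ ω, |G ω| ≤ C) →
        ∫ ω, F (ω \ ↑B₁) * G (ω ∩ ↑B₁) ∂μ = (∫ ω, F (ω \ ↑B₁) ∂μ) * ∫ ω, G (ω ∩ ↑B₁) ∂μ)
    (hind₂ : ∀ (F G : BondConfig V → ℝ), Measurable F → Measurable G → (∃ C, ∀ ω, |F ω| ≤ C) →
      (∃ C, ∀ ω, |G ω| ≤ C) →
        ∫ ω, F (ω \ ↑B₂) * G (ω ∩ ↑B₂) ∂μ = (∫ ω, F (ω \ ↑B₂) ∂μ) * ∫ ω, G (ω ∩ ↑B₂) ∂μ)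
    (φ₁ φ₂ : Finset (Sym2 V) → ℝ) (h₁ : ∫ ω, φ₁ (obs ω B₁) ∂μ = 0)
    (h₂ : ∫ ω, φ₂ (obs ω B₂) ∂μ = 0) :
    ∫ ω, {ω | ∃ e ∈ B₁, e ∈ supp (E.hist n ω)}.indicator (fun ω => φ₁ (obs ω B₁)) ω *
        {ω | ∃ e ∈ B₂, e ∈ supp (E.hist n ω)}.indicator (fun ω => φ₂ (obs ω B₂)) ω ∂μ = 0 := by
  -- the "first meeting of both blocks happens now" predicate on histories
  let FB : ProbeHistory V → Prop := fun h =>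
    ¬((∃ e ∈ B₁, e ∈ supp h) ∧ ∃ e ∈ B₂, e ∈ supp h) ∧
      ∃ D, E.next h = some D ∧ (∃ e ∈ B₁, e ∈ D ∪ supp h) ∧ ∃ e ∈ B₂, e ∈ D ∪ supp h
  let g : BondConfig V → ℝ := fun ω => φ₁ (obs ω B₁) * φ₂ (obs ω B₂)
  -- after a first meeting at `t`, both blocks are met at every later time; so it happens once
  have hafter : ∀ {t t' : ℕ} {ω : BondConfig V}, t < t' → FB (E.hist t ω) →
      (∃ e ∈ B₁, e ∈ supp (E.hist t' ω)) ∧ ∃ e ∈ B₂, e ∈ supp (E.hist t' ω) := by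
    intro t t' ω hlt hF
    obtain ⟨-, D, hD, ⟨e₁, he₁, he₁'⟩, ⟨e₂, he₂, he₂'⟩⟩ := hF
    have hsub : D ∪ supp (E.hist t ω) ⊆ supp (E.hist t' ω) := by
      rw [← E.supp_hist_succ_of_some hD]
      exact E.supp_hist_mono (by omega) ω
    exact ⟨⟨e₁, he₁, hsub he₁'⟩, ⟨e₂, he₂, hsub he₂'⟩⟩
  have huniq : ∀ {t t' : ℕ} {ω : BondConfig V}, FB (E.hist t ω) → FB (E.hist t' ω) → t = t' := by
    intro t t' ω hF hF'
    by_contra hne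
    rcases lt_or_gt_of_ne hne with hlt | hlt
    · exact hF'.1 (hafter hlt hF)
    · exact hF.1 (hafter hlt hF')
  -- pointwise decomposition of the integrand along the first meeting time
  have hpt : ∀ ω, {ω | ∃ e ∈ B₁, e ∈ supp (E.hist n ω)}.indicator (fun ω => φ₁ (obs ω B₁)) ω *
      {ω | ∃ e ∈ B₂, e ∈ supp (E.hist n ω)}.indicator (fun ω => φ₂ (obs ω B₂)) ω =
      ∑ t ∈ Finset.range n, {ω | FB (E.hist t ω)}.indicator g ω := by
    intro ω
    by_cases hboth : (∃ e ∈ B₁, e ∈ supp (E.hist n ω)) ∧ ∃ e ∈ B₂, e ∈ supp (E.hist n ω)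
    · obtain ⟨t₀, ht₀n, hF₀⟩ := E.exists_firstBoth hboth.1 hboth.2
      rw [Finset.sum_eq_single_of_mem t₀ (Finset.mem_range.2 ht₀n) fun t _ htne => ?_]
      · rw [Set.indicator_of_mem (show ω ∈ {ω | ∃ e ∈ B₁, e ∈ supp (E.hist n ω)} from hboth.1),
          Set.indicator_of_mem (show ω ∈ {ω | ∃ e ∈ B₂, e ∈ supp (E.hist n ω)} from hboth.2),
          Set.indicator_of_mem (show ω ∈ {ω | FB (E.hist t₀ ω)} from hF₀)]
      · exact Set.indicator_of_notMem
          (show ω ∉ {ω | FB (E.hist t ω)} from fun hF => htne (huniq hF hF₀)) g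
    · have hzero : ∀ t ∈ Finset.range n, {ω | FB (E.hist t ω)}.indicator g ω = 0 := fun t ht =>
        Set.indicator_of_notMem
          (show ω ∉ {ω | FB (E.hist t ω)} from fun hF => hboth (hafter (Finset.mem_range.1 ht) hF)) g
      rw [Finset.sum_eq_zero hzero]
      rcases not_and_or.1 hboth with h | h
      · rw [Set.indicator_of_notMem (show ω ∉ {ω | ∃ e ∈ B₁, e ∈ supp (E.hist n ω)} from h),
          zero_mul]
      · rw [Set.indicator_of_notMem (show ω ∉ {ω | ∃ e ∈ B₂, e ∈ supp (E.hist n ω)} from h),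
          mul_zero]
  simp_rw [hpt]
  -- measurability and boundedness of `g`
  have hgm : Measurable g := (measurable_comp_obs B₁ φ₁).mul (measurable_comp_obs B₂ φ₂)
  let K : ℝ := (∑ o ∈ B₁.powerset, |φ₁ o|) * ∑ o ∈ B₂.powerset, |φ₂ o|
  have hgK : ∀ ω, ‖g ω‖ ≤ K := fun ω => by
    rw [Real.norm_eq_abs, abs_mul]
    exact mul_le_mul (abs_comp_obs_le B₁ φ₁ ω) (abs_comp_obs_le B₂ φ₂ ω) (abs_nonneg _)
      ((abs_nonneg _).trans (abs_comp_obs_le B₁ φ₁ ω))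
  have hgi : Integrable g μ := Integrable.of_bound hgm.aestronglyMeasurable K (ae_of_all _ hgK)
  have hAt : ∀ t, MeasurableSet {ω | FB (E.hist t ω)} := fun t => E.measurableSet_setOf_hist' t FB
  have hint : ∀ t ∈ Finset.range n, Integrable ({ω | FB (E.hist t ω)}.indicator g) μ := fun t _ =>
    hgi.indicator (hAt t)
  rw [integral_finsetSum _ hint]
  refine Finset.sum_eq_zero fun t _ => ?_
  -- decompose `{FB (hist t)}` along the histories
  rw [integral_indicator (hAt t)]
  have hU : {ω | FB (E.hist t ω)} = ⋃ h : {h : ProbeHistory V // FB h}, {ω | E.hist t ω = h.1} := by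
    ext ω
    simp only [Set.mem_setOf_eq, Set.mem_iUnion]
    exact ⟨fun hF => ⟨⟨E.hist t ω, hF⟩, rfl⟩, fun ⟨h, hh⟩ => hh ▸ h.2⟩
  have hdisj : Pairwise (Function.onFun Disjoint
      fun h : {h : ProbeHistory V // FB h} => {ω | E.hist t ω = h.1}) := by
    intro h h' hne
    refine Set.disjoint_left.2 fun ω hω hω' => hne (Subtype.ext ?_)
    exact hω.symm.trans hω'
  rw [hU, integral_iUnion (s := fun h : {h : ProbeHistory V // FB h} => {ω | E.hist t ω = h.1})
    (fun h => E.measurableSet_hist_eq t h.1) hdisj hgi.integrableOn]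
  refine (tsum_congr fun h => ?_).trans tsum_zero
  -- on `{hist t = h}` with `FB h`: the block not met by `h` carries an independent mean-zero bit
  rw [← integral_indicator (E.measurableSet_hist_eq t h.1)]
  have hind : ∀ ω, {ω | E.hist t ω = h.1}.indicator g ω =
      {ω | E.hist t ω = h.1}.indicator (1 : BondConfig V → ℝ) ω * φ₁ (obs ω B₁) * φ₂ (obs ω B₂) := by
    intro ω
    simp only [Set.indicator_apply, g, Pi.one_apply]
    split_ifs <;> ring
  simp_rw [hind]
  have hIm : Measurable ({ω | E.hist t ω = h.1}.indicator (1 : BondConfig V → ℝ)) :=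
    measurable_one.indicator (E.measurableSet_hist_eq t h.1)
  have hI1 : ∀ ω, |{ω | E.hist t ω = h.1}.indicator (1 : BondConfig V → ℝ) ω| ≤ 1 := fun ω => by
    simp only [Set.indicator_apply, Pi.one_apply]; split_ifs <;> simp
  rcases not_and_or.1 h.2.1 with hno | hno
  · -- `h` does not meet `B₁`: isolate `φ₁`
    have hS : Disjoint (↑(supp h.1) : Set (Sym2 V)) ↑B₁ :=
      Set.disjoint_left.2 fun e he he' => hno ⟨e, he', he⟩
    have hpt' : ∀ ω, {ω | E.hist t ω = h.1}.indicator (1 : BondConfig V → ℝ) ω * φ₁ (obs ω B₁) *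
        φ₂ (obs ω B₂) =
        ({ω | E.hist t ω = h.1}.indicator (1 : BondConfig V → ℝ) (ω \ ↑B₁) * φ₂ (obs (ω \ ↑B₁) B₂)) *
          φ₁ (obs (ω ∩ ↑B₁) B₁) := by
      intro ω
      rw [← indicator_one_eq_indicator_sdiff_of_determinedBy (E.determinedBy_hist t h.1) hS ω,
        obs_sdiff_eq_of_disjoint hB, obs_inter_eq]
      ring
    simp_rw [hpt']
    rw [hind₁ (fun ω => {ω | E.hist t ω = h.1}.indicator (1 : BondConfig V → ℝ) ω * φ₂ (obs ω B₂))
      (fun ω => φ₁ (obs ω B₁)) (hIm.mul (measurable_comp_obs B₂ φ₂)) (measurable_comp_obs B₁ φ₁)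
      ⟨1 * ∑ o ∈ B₂.powerset, |φ₂ o|, fun ω => by
        rw [abs_mul]
        exact mul_le_mul (hI1 ω) (abs_comp_obs_le B₂ φ₂ ω) (abs_nonneg _) zero_le_one⟩
      ⟨_, abs_comp_obs_le B₁ φ₁⟩]
    simp_rw [obs_inter_eq]
    rw [h₁, mul_zero]
  · -- `h` does not meet `B₂`: isolate `φ₂`
    have hS : Disjoint (↑(supp h.1) : Set (Sym2 V)) ↑B₂ :=
      Set.disjoint_left.2 fun e he he' => hno ⟨e, he', he⟩
    have hpt' : ∀ ω, {ω | E.hist t ω = h.1}.indicator (1 : BondConfig V → ℝ) ω * φ₁ (obs ω B₁) *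
        φ₂ (obs ω B₂) =
        ({ω | E.hist t ω = h.1}.indicator (1 : BondConfig V → ℝ) (ω \ ↑B₂) * φ₁ (obs (ω \ ↑B₂) B₁)) *
          φ₂ (obs (ω ∩ ↑B₂) B₂) := by
      intro ω
      rw [← indicator_one_eq_indicator_sdiff_of_determinedBy (E.determinedBy_hist t h.1) hS ω,
        obs_sdiff_eq_of_disjoint hB.symm, obs_inter_eq]
    simp_rw [hpt']
    rw [hind₂ (fun ω => {ω | E.hist t ω = h.1}.indicator (1 : BondConfig V → ℝ) ω * φ₁ (obs ω B₁))
      (fun ω => φ₂ (obs ω B₂)) (hIm.mul (measurable_comp_obs B₁ φ₁)) (measurable_comp_obs B₂ φ₂)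
      ⟨1 * ∑ o ∈ B₁.powerset, |φ₁ o|, fun ω => by
        rw [abs_mul]
        exact mul_le_mul (hI1 ω) (abs_comp_obs_le B₁ φ₁ ω) (abs_nonneg _) zero_le_one⟩
      ⟨_, abs_comp_obs_le B₂ φ₂⟩]
    simp_rw [obs_inter_eq]
    rw [h₂, mul_zero]

/-- **(B.7) Orthogonality of revealed bits for `M_k`, for two disjoint ALIGNED blocks** (registered
helper of the stub `stub_fourArmAboveOne`; the input `horth` of the Garban scheme data `hS` of
`fourArmAboveOneAlong_of_garbanScheme`).  Let `E` be any explorer of bond configurations of `ℤ²`,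
`B_l = blockPairs j_l R_l` (`l = 1, 2`) two disjoint blocks aligned with the coarse lattice
(`k ∣ j_l i ± R_l`), `φ_l (obs ω B_l)` bits of `M_k(ρ,c₀)`-mean zero, and `Y_l` the indicator
that some probe made before time `n` meets `B_l`.  Then `∫ (C₁ Y₁)(C₂ Y₂) dM_k(ρ,c₀) = 0`: under
`M_k` the inside and the outside of an aligned block are independent
(`M_integral_mul_eq_mul_integral_of_aligned`), which is all (B.7) uses
(`integral_revealedBits_mul_eq_zero_of_decoupled`). -/
theorem M_integral_revealedBits_mul_eq_zero {k : ℕ} (hk : 0 < k) (ρ c₀ : ℝ) (E : Explorer (Site 2))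
    (n : ℕ) {j₁ j₂ : Site 2} {R₁ R₂ : ℕ}
    (hal₁ : ∀ i, (k : ℤ) ∣ j₁ i - R₁ ∧ (k : ℤ) ∣ j₁ i + R₁)
    (hal₂ : ∀ i, (k : ℤ) ∣ j₂ i - R₂ ∧ (k : ℤ) ∣ j₂ i + R₂)
    (hB : Disjoint (blockPairs j₁ R₁) (blockPairs j₂ R₂)) (φ₁ φ₂ : Finset (Sym2 (Site 2)) → ℝ)
    (h₁ : ∫ ω, φ₁ (obs ω (blockPairs j₁ R₁)) ∂(M k ρ c₀) = 0)
    (h₂ : ∫ ω, φ₂ (obs ω (blockPairs j₂ R₂)) ∂(M k ρ c₀) = 0) :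
    ∫ ω, {ω | ∃ e ∈ blockPairs j₁ R₁, e ∈ supp (E.hist n ω)}.indicator
          (fun ω => φ₁ (obs ω (blockPairs j₁ R₁))) ω *
        {ω | ∃ e ∈ blockPairs j₂ R₂, e ∈ supp (E.hist n ω)}.indicator
          (fun ω => φ₂ (obs ω (blockPairs j₂ R₂))) ω ∂(M k ρ c₀) = 0 := by
  haveI := isProbabilityMeasure_M k ρ c₀
  refine integral_revealedBits_mul_eq_zero_of_decoupled (M k ρ c₀) E n hB ?_ ?_ φ₁ φ₂ h₁ h₂
  · rintro F G hF hG ⟨CF, hCF⟩ ⟨CG, hCG⟩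
    exact M_integral_mul_eq_mul_integral_of_aligned hk ρ c₀ hal₁ hF hG hCF hCG
  · rintro F G hF hG ⟨CF, hCF⟩ ⟨CG, hCG⟩
    exact M_integral_mul_eq_mul_integral_of_aligned hk ρ c₀ hal₂ hF hG hCF hCG

/-! ### Pivotal blocks that are a.s. examined: `E[f C ; B pivotal] = E[f C ; B examined]` -/

/-- **`E[f C ; B pivotal] = E[f C ; B revealed]` for a general law `μ` under which the block is
independent of its outside**, when the `B`-pivotal event of `f` is `μ`-a.s. contained in the
revealment event of `B` (port of the tree's
`Explorer.integral_indicator_pivotal_mul_bit_eq_setIntegral_revealed`, van den Berg–Nolin 2020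
§5.2 (G-B4a)–(G-B8)): split `f = 1_{piv} f + 1_{nonpiv} f`; the revealment event
(`Explorer.determinedBy_revealed`) and the non-pivotal event are determined by the edges off `B`,
and on the latter `f(ω) = f(ω ∖ B)`, so the non-pivotal part is (a function of `ω ∖ B`) times
the mean-zero bit (a function of `ω ∩ B`) and integrates to zero. -/
theorem integral_indicator_pivotal_mul_bit_eq_setIntegral_revealed_of_decoupled {V : Type*}
    [Countable V] (μ : Measure (BondConfig V)) [IsFiniteMeasure μ] (E : Explorer V) (n : ℕ)
    (B : Finset (Sym2 V))
    (hind : ∀ (F G : BondConfig V → ℝ), Measurable F → Measurable G → (∃ C, ∀ ω, |F ω| ≤ C) →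
      (∃ C, ∀ ω, |G ω| ≤ C) →
        ∫ ω, F (ω \ ↑B) * G (ω ∩ ↑B) ∂μ = (∫ ω, F (ω \ ↑B) ∂μ) * ∫ ω, G (ω ∩ ↑B) ∂μ)
    (φ : Finset (Sym2 V) → ℝ) (h0 : ∫ ω, φ (obs ω B) ∂μ = 0)
    {f : BondConfig V → ℝ} (hfm : Measurable f) {K : ℝ} (hfK : ∀ ω, |f ω| ≤ K)
    (hpiv : ∀ᵐ ω ∂μ, (∃ ξ ⊆ (↑B : Set (Sym2 V)), f (ω \ ↑B ∪ ξ) ≠ f ω) →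
      ∃ e ∈ B, e ∈ supp (E.hist n ω)) :
    ∫ ω, {ω | ∃ ξ ⊆ (↑B : Set (Sym2 V)), f (ω \ ↑B ∪ ξ) ≠ f ω}.indicator f ω * φ (obs ω B) ∂μ =
      ∫ ω in {ω | ∃ e ∈ B, e ∈ supp (E.hist n ω)}, f ω * φ (obs ω B) ∂μ := by
  let Y : Set (BondConfig V) := {ω | ∃ e ∈ B, e ∈ supp (E.hist n ω)}
  let Pv : Set (BondConfig V) := {ω | ∃ ξ ⊆ (↑B : Set (Sym2 V)), f (ω \ ↑B ∪ ξ) ≠ f ω}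
  let N : Set (BondConfig V) := {ω | ∀ ξ ⊆ (↑B : Set (Sym2 V)), f (ω \ ↑B ∪ ξ) = f ω}
  have hYm : MeasurableSet Y := E.measurableSet_setOf_hist' n fun h => ∃ e ∈ B, e ∈ supp h
  have hNm : MeasurableSet N := measurableSet_blockNonPivotal B hfm
  have hNPv : ∀ ω, ω ∈ N ↔ ω ∉ Pv := fun ω => by simp [N, Pv]
  have hbit := measurable_comp_obs B φ
  have hBB : Disjoint ((↑B : Set (Sym2 V))ᶜ) ↑B := disjoint_compl_left
  -- pointwise splitting of the revealed integrand
  have hsplit : ∀ ω, Y.indicator (fun ω => f ω * φ (obs ω B)) ω =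
      Y.indicator (1 : BondConfig V → ℝ) ω * (Pv.indicator f ω * φ (obs ω B)) +
        (Y.indicator (1 : BondConfig V → ℝ) (ω \ ↑B) * N.indicator (1 : BondConfig V → ℝ) (ω \ ↑B) *
          f ((ω \ ↑B) \ ↑B)) * φ (obs (ω ∩ ↑B) B) := by
    intro ω
    rw [← indicator_one_eq_indicator_sdiff_of_determinedBy (E.determinedBy_revealed n B) hBB ω,
      ← indicator_one_eq_indicator_sdiff_of_determinedBy (determinedBy_blockNonPivotal B f) hBB ω,
      sdiff_idem, obs_inter_eq]
    by_cases hY : ω ∈ Y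
    · rw [Set.indicator_of_mem hY, Set.indicator_of_mem hY, Pi.one_apply, one_mul, one_mul]
      by_cases hP : ω ∈ Pv
      · rw [Set.indicator_of_mem hP, Set.indicator_of_notMem (fun h => (hNPv ω).1 h hP)]
        ring
      · have hN : ω ∈ N := (hNPv ω).2 hP
        rw [Set.indicator_of_notMem hP, Set.indicator_of_mem hN, Pi.one_apply,
          apply_eq_apply_sdiff_of_mem_blockNonPivotal hN]
        ring
    · rw [Set.indicator_of_notMem hY, Set.indicator_of_notMem hY]
      ring
  -- integrability
  have hind1 : ∀ (S : Set (BondConfig V)) (ω : BondConfig V),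
      |S.indicator (1 : BondConfig V → ℝ) ω| ≤ 1 := fun S ω => by
    simp only [Set.indicator_apply, Pi.one_apply]; split_ifs <;> simp
  have hPvf : Measurable (Pv.indicator f) := hfm.indicator (measurableSet_blockPivotal B hfm)
  have hPvfK : ∀ ω, |Pv.indicator f ω| ≤ |K| := fun ω => by
    simp only [Set.indicator_apply]
    split_ifs
    · exact (hfK ω).trans (le_abs_self K)
    · simp
  have hA : Integrable (fun ω => Y.indicator (1 : BondConfig V → ℝ) ω *
      (Pv.indicator f ω * φ (obs ω B))) μ := by
    refine Integrable.of_bound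
      (((measurable_const (a := (1 : ℝ))).indicator hYm).mul (hPvf.mul hbit)).aestronglyMeasurable
      (1 * (|K| * ∑ o ∈ B.powerset, |φ o|)) (ae_of_all _ fun ω => ?_)
    rw [Real.norm_eq_abs, abs_mul, abs_mul]
    exact mul_le_mul (hind1 Y ω) (mul_le_mul (hPvfK ω) (abs_comp_obs_le B φ ω) (abs_nonneg _)
      (abs_nonneg _)) (by positivity) zero_le_one
  -- the non-pivotal part, as (function of `ω ∖ B`) × (bit of `ω ∩ B`)
  let F : BondConfig V → ℝ := fun η =>
    Y.indicator (1 : BondConfig V → ℝ) η * N.indicator (1 : BondConfig V → ℝ) η * f (η \ ↑B)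
  have hsd : Measurable fun ω : BondConfig V => f (ω \ ↑B) := hfm.comp (measurable_sdiff_right _)
  have hFm : Measurable F :=
    (((measurable_const (a := (1 : ℝ))).indicator hYm).mul
      ((measurable_const (a := (1 : ℝ))).indicator hNm)).mul hsd
  have hFK : ∀ η, |F η| ≤ 1 * 1 * |K| := fun η => by
    simp only [F]
    rw [abs_mul, abs_mul]
    exact mul_le_mul (mul_le_mul (hind1 Y η) (hind1 N η) (abs_nonneg _) zero_le_one)
      ((hfK _).trans (le_abs_self K)) (abs_nonneg _) (by positivity)
  have hBm : Integrable (fun ω => F (ω \ ↑B) * φ (obs (ω ∩ ↑B) B)) μ := by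
    refine Integrable.of_bound
      ((hFm.comp (measurable_sdiff_right _)).mul
        (hbit.comp (measurable_inter_right _))).aestronglyMeasurable
      (1 * 1 * |K| * ∑ o ∈ B.powerset, |φ o|) (ae_of_all _ fun ω => ?_)
    rw [Real.norm_eq_abs, abs_mul]
    exact mul_le_mul (hFK _) (abs_comp_obs_le B φ _) (abs_nonneg _) (by positivity)
  -- the non-pivotal part vanishes
  have hzero : ∫ ω, F (ω \ ↑B) * φ (obs (ω ∩ ↑B) B) ∂μ = 0 := by
    rw [hind F (fun η => φ (obs η B)) hFm hbit ⟨_, hFK⟩ ⟨_, abs_comp_obs_le B φ⟩]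
    simp_rw [obs_inter_eq]
    rw [h0, mul_zero]
  -- the pivotal part is a.s. revealed
  have hae : (fun ω => Y.indicator (1 : BondConfig V → ℝ) ω * (Pv.indicator f ω * φ (obs ω B))) =ᵐ[μ]
      fun ω => Pv.indicator f ω * φ (obs ω B) := by
    filter_upwards [hpiv] with ω hω
    by_cases hP : ω ∈ Pv
    · rw [Set.indicator_of_mem (show ω ∈ Y from hω hP), Pi.one_apply, one_mul]
    · rw [Set.indicator_of_notMem hP, zero_mul, mul_zero]
  symm
  rw [← integral_indicator hYm, integral_congr_ae (ae_of_all _ hsplit), integral_add hA hBm, hzero,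
    add_zero, integral_congr_ae hae]

/-- **`E[f C ; B pivotal] = E[f C ; B revealed]` under `M_k` for an ALIGNED block** (registered
helper of the stub `stub_fourArmAboveOne`): for `B = blockPairs j R` aligned with the coarse
lattice (`k ∣ j i ± R`), a bit `φ (obs ω B)` of `M_k(ρ,c₀)`-mean zero, `f` bounded measurable whose
`B`-pivotal event is `M_k`-a.s. contained in the revealment event of `B` by the explorer `E`
before time `n`, only the revealed event contributes to `E[f C ; B pivotal]`
(`integral_indicator_pivotal_mul_bit_eq_setIntegral_revealed_of_decoupled` with the aligned-block
decoupling `M_integral_mul_eq_mul_integral_of_aligned`). -/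
theorem M_integral_indicator_pivotal_mul_bit_eq_setIntegral_revealed {k : ℕ} (hk : 0 < k) (ρ c₀ : ℝ)
    (E : Explorer (Site 2)) (n : ℕ) {j : Site 2} {R : ℕ}
    (hal : ∀ i, (k : ℤ) ∣ j i - R ∧ (k : ℤ) ∣ j i + R) (φ : Finset (Sym2 (Site 2)) → ℝ)
    (h0 : ∫ ω, φ (obs ω (blockPairs j R)) ∂(M k ρ c₀) = 0)
    {f : BondConfig (Site 2) → ℝ} (hfm : Measurable f) {K : ℝ} (hfK : ∀ ω, |f ω| ≤ K)
    (hpiv : ∀ᵐ ω ∂(M k ρ c₀),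
      (∃ ξ ⊆ (↑(blockPairs j R) : Set (Sym2 (Site 2))), f (ω \ ↑(blockPairs j R) ∪ ξ) ≠ f ω) →
        ∃ e ∈ blockPairs j R, e ∈ supp (E.hist n ω)) :
    ∫ ω, {ω | ∃ ξ ⊆ (↑(blockPairs j R) : Set (Sym2 (Site 2))),
        f (ω \ ↑(blockPairs j R) ∪ ξ) ≠ f ω}.indicator f ω * φ (obs ω (blockPairs j R)) ∂(M k ρ c₀) =
      ∫ ω in {ω | ∃ e ∈ blockPairs j R, e ∈ supp (E.hist n ω)}, f ω * φ (obs ω (blockPairs j R))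
        ∂(M k ρ c₀) := by
  haveI := isProbabilityMeasure_M k ρ c₀
  refine integral_indicator_pivotal_mul_bit_eq_setIntegral_revealed_of_decoupled (M k ρ c₀) E n
    (blockPairs j R) ?_ φ h0 hfm hfK hpiv
  rintro F G hF hG ⟨CF, hCF⟩ ⟨CG, hCG⟩
  exact M_integral_mul_eq_mul_integral_of_aligned hk ρ c₀ hal hF hG hCF hCG

end Summit.CriticalPhenomena.CardyFormulaZ2.Theorems.CardySelfRefinement.FarField

end
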